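import Literature.NumberTheory.GaloisRepresentations.CompatibleSystemIrreducibility
import HarnessLib

/-!
# The members of a weakly compatible system through a potentially automorphic odd symplectic
# `r : Γ_ℚ → GL₄(ℚ̄_p)` are irreducible AND SYMPLECTIC WITH MULTIPLIER `ε_ℓ⁻¹` at a set of primes
# `ℓ` of positive Dirichlet density
# (Bellaïche–Chenevier 2011, Cor. 1.3 — the sign of the automorphic restriction — with
# Patrikis–Taylor 2015, Thm. 1.7, transported along Barnet-Lamb–Gee–Geraghty–Taylor 2014,
# Cor. 4.5.2)

Topic `Literature/NumberTheory/GaloisRepresentations`; sequel of `CompatibleSystemIrreducibility`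
(`PatrikisTaylor2015_thm17_irreducibleMembers_rat_GL4`, accepted p169196: IRREDUCIBILITY of the
members at a set of primes of positive density), whose binders are repeated here symbol for symbol
and whose conclusion is strengthened by ONE conjunct — the members are symplectic with multiplier
exactly `ε_ℓ⁻¹` — on the SAME set of primes (`….irreducibleMembers` below recovers the sibling by
projection).  Cite item of the crux `stmt-Langlands-17765`
(`Summit.Langlands.Langlands.Theses.AbelianSurfaceSerre.SerreGSp4Surjective`), line
`singer-type-evaporation`, stub `stub_companionsSymp` (skeleton v9: the `ℓ`-adic companions fed to
the landed Barnet-Lamb–Gee–Geraghty–Taylor Thm. 4.2.1 stub must be symplectic with multiplier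
`ε_ℓ⁻¹`; the accepted `BLGGT2014_thm551_compatibleSystem_rat_GL4` asserts no self-duality of the
members other than `r`, as print asserts none — its module docstring, "What the conclusion does NOT
say").  One NAMED FACT (D-0014),
`BellaicheChenevier2011_cor13_irreducibleSymplecticMembers_rat_GL4`, a COMPOSITE of three printed
theorems and standard glue, exactly as the sibling is (derivation below, step by step, printed
steps and glue marked).  Both conclusions are delivered on ONE set of primes on purpose: two sets
of merely positive density may be disjoint, and the consumer needs a prime carrying both.

## The printed statements (held texts, read 2026-08-17)

* [BLGGT] T. Barnet-Lamb, T. Gee, D. Geraghty, R. Taylor, *Potential automorphy and change of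
  weight*, Ann. of Math. 179 (2014) 501–609 [BarnetlambEtAl2014]; held text arXiv:1010.2561
  (§4.5 and §2.1 carry the published numbers; arXiv Thm. 5.4.1 = published Thm. 5.5.1).
  **§2.1** (p. 17), verbatim: "We will call the pair `(r, μ)` … essentially conjugate self-dual
  if for some infinite place `v` of `F⁺` there is `ε_v ∈ {±1}` and a non-degenerate pairing
  `⟨ , ⟩_v` on `ℚ̄_l^n` … such that `⟨x, y⟩_v = ε_v ⟨y, x⟩_v` and
  `⟨r(σ)x, r(c_v σ c_v) y⟩_v = μ(σ)⟨x, y⟩_v` … for all `σ ∈ G_F`."  "If `F` is totally real then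
  `(r, μ)` is essentially conjugate self-dual if and only if `r` factors through `GSp_n(ℚ̄_l)` (if
  `μ(c_v) = −ε_v`) or `GO_n(ℚ̄_l)` (if `μ(c_v) = ε_v`) with multiplier `μ`. [Define the pairing
  on `ℚ̄_l^n` by `⟨x, y⟩ = ⟨x, r(c_v) y⟩_v`.]"  "We will call `(r, μ)` … totally odd, essentially
  conjugate self-dual if they are essentially conjugate self-dual and `ε_v = 1` for all
  `v ∣ ∞`."  **§2.1** (p. 18), verbatim: "We recall that to a RAESDC or RAECSDC representation
  `(π, χ)` of `GL_n(𝔸_F)` we can attach a continuous semi-simple representation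
  `r_{l,ı}(π) : G_F → GL_n(ℚ̄_l)` with the properties described in Theorem 1.1 (resp. 1.2) of
  [blght].  The pair `(r_{l,ı}(π), ε_l^{1−n} r_{l,ı}(χ))` is totally odd, essentially conjugate
  self-dual. (See Theorem 1.2 and Corollary 1.3 of [belchen]. Note that Theorem 1.2 of [belchen]
  can easily be extended to the case `χ` non-trivial by a twisting argument. Also note that
  irreducible factors `r` of `r_{l,ı}(π)` which do not satisfy `r^c ≅ r^∨ ⊗ ε_l^{1−n} r_{l,ı}(χ)`
  occur in pairs `r, (r^c)^∨ ⊗ ε_l^{1−n} r_{l,ı}(χ)` and it is straightforward to put a pairing of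
  the desired form on `r ⊕ (r^c)^∨ ⊗ ε_l^{1−n} r_{l,ı}(χ)`.)"  ([belchen] = J. Bellaïche,
  G. Chenevier, *The sign of Galois representations attached to automorphic forms for unitary
  groups* — the paper [BellaicheChenevier2011] below; [blght] Thm. 1.1 = the existence and local
  properties of `r_{l,ı}(π)` for RAESDC `π` over totally real `F`, published as [BLGGT]
  Thm. 2.1.1.)  Same page: "We will call a pair `(r, μ)` … automorphic if there is a RAESDC or
  RAECSDC representation `(π, χ)` such that `(r, μ) ≅ (r_{l,ı}(π), r_{l,ı}(χ) ε_l^{1−n})`", and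
  (p. 17) a RAESDC `(π, χ)` of `GL_n(𝔸_F)`, `F` totally real, has "`χ : 𝔸_F^×/F^× → ℂ^×` a
  continuous character such that `χ_v(−1)` is independent of `v ∣ ∞`, and
  `π ≅ π^∨ ⊗ (χ ∘ det)`".
  **Corollary 4.5.2** (§4.5, p. 30 of the held text), verbatim: "Suppose `F⁺` is a totally real
  field and `n ∈ ℤ_{≥1}`. Suppose that `l ≥ 2(n+1)` is a rational prime. Suppose also that
  `r : G_{F⁺} → GL_n(ℚ̄_l)` is an continuous representation and that `μ : G_{F⁺} → ℚ̄_l^×` is a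
  continuous character. Let `r̄` denote the semi-simplification of the reduction of `r`. Suppose
  that the following conditions hold. (1) (Being unramified almost everywhere) `r` is unramified
  at all but finitely many primes. (2) (Odd essential self-duality) `(r, μ)` is totally odd,
  essentially conjugate self-dual. (3) (Potential diagonalizability and regularity at primes above
  `l`) `r` is potentially diagonalizable (and hence potentially crystalline) at each prime `v` of
  `F⁺` above `l` and for each `τ : F ↪ ℚ̄_l` the multiset `HT_τ(r)` contains `n` distinct
  elements. (4) (Irreducibility) `r̄|_{G_{F⁺(ζ_l)}}` is irreducible. Then there is a Galois
  totally real extension `F⁺'/F⁺` such that `(r|_{G_{F⁺'}}, μ|_{G_{F⁺'}})` is automorphic of level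
  prime to `l`."  **§5.1** (pp. 32–33): weakly compatible systems (quoted in
  `CompatibleSystemResidualIrreducibility`); "if `(π, χ)` is a RAECSDC or RAESDC automorphic
  representation of `GL_n(𝔸_F)` then `{r_{l,ı}(χ)}` is a strictly pure compatible system … Then
  Caraiani has proved that `{r_{l,ı}(π)}` is a strictly pure compatible system".  **Proof of
  Thm. 5.4.1 (held) = 5.5.1 (published)** (pp. 39–40): the system through `r` is built from a
  Galois totally real `F'/F`, `ı : ℚ̄_l ≅ ℂ` and a RAESDC `(π, χ)` of `GL_n(𝔸_{F'})` "such that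
  `r_{l,ı}(π) ≅ r|_{G_{F'}}`" (Cor. 4.5.2), by Brauer induction from the `r_{l',ı'}(π^{(F'_i)})`.
  **Lemma 1.4.3** (p. 15): ordinary / Fontaine–Laffaille ⇒ potentially diagonalizable (quoted in
  `Automorphic/PotentialAutomorphyCompatibleSystemGL4Rational`).
* [BC] J. Bellaïche, G. Chenevier, *The sign of Galois representations attached to automorphic
  forms for unitary groups*, Compositio Math. 147 (2011) 1337–1352 [BellaicheChenevier2011]; held
  text arXiv:0804.2860 (the 2008 version: it contains §1.1 and Theorem 1.2 below; the totally real
  Corollary 1.3 of the published version is held here through its two printed USES, [BLGGT] §2.1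
  p. 18 above and [P] below).  **§1.1**, verbatim: "Let `ρ` be a semi-simple representation
  `G → GL_n(L)` such that `ρ^⊥ ≃ ρ χ` [`ρ^⊥(g) = ᵗρ(g^c)⁻¹`] … By Schur's lemma there exists a
  unique (up to a scalar) matrix `A ∈ GL_n(L)` such that `ρ^⊥ = A ρ A⁻¹ χ`. Applying this relation
  twice, we see that `A ᵗA⁻¹` commutes with `ρ^⊥`, hence by Schur's lemma again is a scalar matrix
  `λ`. So `ᵗA = λA` and `λ = ±1`. This sign is called the sign of `ρ`."  **Theorem 1.2**, verbatim:
  "For every finite prime `λ` of `E(Π)`, every irreducible factor of `ρ_{Π,λ}` that satisfies (1)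
  has sign `+1`" (`Π` cuspidal polarized algebraic regular on `GL_n` over a CM field `K`).
  **§1.4, footnote** (the totally real ⇄ CM dictionary behind Cor. 1.3), verbatim: "an even
  dimensional absolutely irreducible representation `r` of `G_F`, say of dimension `2n`,
  `r : G_F → GL_{2n}(L)` … satisfies `r^∨ ≃ r ω^{2n−1}` so `ᵗr(g)⁻¹ = P r(g) P⁻¹ ω(g)^{2n−1}` …
  and Chenevier–Clozel result is that `P` is anti-symmetric. We claim that this implies that the
  restriction `ρ = r|G_K` … has sign `+1`. … `ᵗA = ᵗP ᵗr(c) = (−P) r(c) = r(c) P = A`."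
* [P] S. Patrikis, *On the sign of regular algebraic polarizable automorphic representations*,
  Math. Ann. 362 (2015), held text arXiv:1306.1242, §3 (p. 10 of the held text), verbatim — the
  second printed use of [BC] Cor. 1.3 for RAESDC representations over a totally real field: "For
  all `i`, `ρ_{i,ι}` preserves a pairing of sign `ω_ι(c_v) = (−1)^w ω_v(−1)`, where `c_v` denotes
  complex conjugation at `v ∣ ∞`, and `ω_ι` the associated geometric Galois character: this
  follows from Theorem (mainthm) above and, more important, Corollary 1.3 of
  [bellaiche-chenevier:sign]. [And by the fact that non-self-dual irreducible constituents of
  `ρ_{σ_i,ι}` come in (dual) pairs, and on such a pair `r ⊕ (r^∨ ⊗ ω_ι)` we can put an invariant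
  pairing of any sign we like.]"
* [PT] S. Patrikis, R. Taylor, *Automorphy and irreducibility of some l-adic representations*,
  Compositio Math. 151 (2015) 207–229 [PatrikisTaylor2014]; held text arXiv:1307.1640.
  **Theorem 1.7**, verbatim: "Suppose that `F` is a CM field and that `π` is a polarizable,
  regular algebraic, cuspidal automorphic representation of `GL_n(𝔸_F)`. Then there is a finite
  CM extension `M/M_π` and a Dirichlet density `1` set `𝓛` of rational primes, such that for all
  conjugation-invariant primes `λ` of `M` dividing an `ℓ ∈ 𝓛`, `r_{π,λ|_{M_π}}` is irreducible.
  In particular, there is a positive Dirichlet density set `𝓛'` of rational primes such that if a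
  prime `λ` of `M_π` divides some `ℓ ∈ 𝓛'`, then `r_{π,λ}` is irreducible."  **Introduction,
  Theorem 4**, verbatim: "Suppose that `F` is a CM (or totally real) field and that `π` is a
  polarizable, regular algebraic, cuspidal automorphic representation of `GL_n(𝔸_F)`. Then there
  is a positive Dirichlet density set `𝓛` such that, for all `l ∈ 𝓛` and all `ı : ℚ̄_l ≅ ℂ`, the
  representation `r_{l,ı}(π)` is irreducible."  Conventions: "by a CM field we will mean a
  number field `F` admitting an automorphism `c`, which coincides with complex conjugation for
  every embedding `F ↪ ℂ` … `[F:F⁺] = 1` or `2`" (totally real fields are CM in this sense);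
  **Lemma 1.5**: "Suppose that `M` is a CM field. Then there is a set of rational primes `Σ` of
  positive Dirichlet density such that all primes of `M` above any element `l ∈ Σ` are
  conjugation invariant … take `Σ` to be the set of rational primes `l` unramified in `M` and with
  `[Frob_l] = {c} ⊂ Gal(M/ℚ)`" (so `𝓛' = 𝓛 ∩ Σ`).
  DENSITY, honestly: for ALL `ı` (equivalently all `λ ∣ ℓ`) print gives a set of POSITIVE
  Dirichlet density, not density one (density one is printed only at conjugation-invariant `λ`
  of an auxiliary CM field `M`, which the consumer cannot steer); hence the conclusion below is
  "`∃ c > 0`, `HasDirichletDensity L' c`", the rendering of the accepted sibling.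

## The rendering, and why it follows from print (read before reviewing)

Statement rendered: for `p ≥ 11`, `r : Γ_ℚ → GL₄(ℚ̄_p)` and `H` satisfying VERBATIM the hypotheses
of `BLGGT2014_thm551_compatibleSystem_rat_GL4` / `PatrikisTaylor2015_thm17_irreducibleMembers_rat_GL4`
(same binders, same order: unramified a.e.; symplectic with multiplier `ε_p⁻¹`; `H.Nodup`,
`card H = 4`, `H` = the labelled Hodge–Tate weights of `r` at `v ∣ p` and there `r`
Fontaine–Laffaille crystalline OR de Rham with `N = 0` and an invariant full flag; `r̄`, read in
`k̄` along `red : 𝒪_{ℚ̄_p} → k̄`, irreducible on `ker ε̄_p`), and for EVERY weakly compatible system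
`(S, Q, H, 𝓡)` of rank `4` over `ℚ` (`IsWeaklyCompatibleSystemRat 4 S Q H 𝓡`) with `𝓡 p ι₀ = r`:
there are `L' ⊆ ℕ` and `c > 0` with `HasDirichletDensity L' c` such that for every prime `ℓ ∈ L'`
and every `ι : ℚ̄_ℓ ≃+* ℂ` the member `𝓡 ℓ ι` is irreducible AND symplectic with multiplier
`ε_ℓ⁻¹` — `(𝓡 ℓ ι).IsSymplecticWithMultiplierFun ν_ℓ`, `ν_ℓ(g) = ε_ℓ(g)⁻¹ ∈ ℚ̄_ℓ` spelled exactly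
as the multiplier hypothesis at `p` (and as the requesting line's `cycInv ℓ`, definitionally):
`∃ J, Jᵀ = −J, det J` a unit, `(𝓡 ℓ ι)(g)ᵀ J (𝓡 ℓ ι)(g) = ε_ℓ(g)⁻¹ • J` for all `g ∈ Γ_ℚ`.

Derivation.  Write `r_ℓ := 𝓡 ℓ ι`.  PRINTED THEOREMS are marked [P·], standard glue [G·].
1. [P1 = [BLGGT] Cor. 4.5.2] with `F⁺ = ℚ`, `n = 4`, `l = p ≥ 11 > 2(n+1)`, `μ = ε_p⁻¹`: the
   hypotheses (1)–(4) are the rendered ones — (2): `r` symplectic with multiplier `μ`,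
   `μ(c) = −1 = −ε_∞` with `ε_∞ = 1`, is "totally odd, essentially self-dual" by the §2.1
   dictionary; (3): Lemma 1.4.3 (2)/(1) for the two alternatives at `v ∣ p`; (4): the residual
   clause (Brauer–Nesbitt), all exactly as in the two sibling files.  OUTPUT: `F'/ℚ` Galois
   totally real, `ı : ℚ̄_p ≅ ℂ` and a RAESDC `(π, χ)` of `GL₄(𝔸_{F'})` with
   `r|_{G_{F'}} ≅ r_{p,ı}(π)` and `ε_p⁻¹|_{G_{F'}} = r_{p,ı}(χ) ε_p^{−3}`, i.e.
   `r_{p,ı}(χ) = ε_p²|_{G_{F'}}` (definition of "automorphic", §2.1 p. 18).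
2. [G1: Chebotarev + Brauer–Nesbitt over `F'`, Clifford] For every `ℓ`, `ι`:
   `r_ℓ|_{G_{F'}} ≅ r_{ℓ,ı'}(π)` with `ı' := ı ∘ ι₀⁻¹ ∘ ι : ℚ̄_ℓ ≅ ℂ` — both sides are semisimple
   (`r_ℓ` is semisimple and `G_{F'} ⊲ G_ℚ` has finite index; `r_{ℓ,ı'}(π)` is semisimple) with
   the same Frobenius characteristic polynomial `ı'⁻¹(Q_{π,w})` at almost every prime `w` of
   `F'` (over `v ∉ S`, `v ∤ pℓ`, `π_w` unramified: `r_ℓ`, `r` carry `ι⁻¹(Q v)`, `ι₀⁻¹(Q v)` at `v`,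
   and `r(Frob_w)` has polynomial `ı⁻¹(Q_{π,w})`), verbatim step 2 of the sibling's derivation
   (this is also how the proof of [BLGGT] Thm. 5.5.1 identifies `r_{l',ı'}|_{G_{F'}}`).  By the
   same argument for the compatible systems of characters `{r_{l,ı'}(χ)}` (§5.1) and `{ε_l²}` of
   `G_{F'}`, which agree at `(p, ı)` by step 1 and have RATIONAL Frobenius values `q_w²` there:
   `r_{ℓ,ı'}(χ) = ε_ℓ²|_{G_{F'}}` for all `ℓ`, `ı'`.
3. [P2 = [PT] Thm. 1.7, second part = Introduction Thm. 4, with Lemma 1.5] for the polarizable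
   (= RAESDC) regular algebraic cuspidal `π` over the totally real (= CM in [PT]'s sense) `F'`:
   a set `L'` of rational primes of POSITIVE Dirichlet density `c` (`L' = 𝓛 ∩ Σ`, `𝓛` of density
   one, `Σ` a Chebotarev set, so `L'` HAS a density `c = density(Σ) > 0`) with `r_{ℓ,ı'}(π)`
   irreducible for all `ℓ ∈ L'` and ALL `ı'`.  Hence, for `ℓ ∈ L'` and every `ι`:
   `r_ℓ|_{G_{F'}}` is irreducible, and a fortiori `r_ℓ` is irreducible (first conjunct).
4. [P3 = [BC] Cor. 1.3, in the form printed in [BLGGT] §2.1 p. 18] `(r_{ℓ,ı'}(π),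
   ε_ℓ^{−3} r_{ℓ,ı'}(χ)) = (r_{ℓ,ı'}(π), ε_ℓ⁻¹|_{G_{F'}})` (step 2) is totally odd, essentially
   self-dual; `F'` is totally real and `μ(c_v) = ε_ℓ⁻¹(c_v) = −1 = −ε_v` (`ε_v = 1`: totally odd),
   so by the §2.1 dictionary `r_{ℓ,ı'}(π)` factors through `GSp₄(ℚ̄_ℓ)` with multiplier `ε_ℓ⁻¹`:
   there is an ALTERNATING non-degenerate `J'` with `r_{ℓ,ı'}(π)(σ)ᵀ J' r_{ℓ,ı'}(π)(σ) = ε_ℓ(σ)⁻¹ J'`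
   for `σ ∈ G_{F'}`.  (The dictionary is the one-line computation printed in brackets: from the
   pairing `⟨ , ⟩_v` of sign `ε_v` put `⟨x, y⟩ = ⟨x, r(c_v) y⟩_v`, which is `G_F`-equivariant with
   multiplier `μ` and has sign `ε_v μ(c_v)`.)
5. [G2: Chebotarev + Brauer–Nesbitt over `ℚ`] `r_ℓ ≅ r_ℓ^∨ ⊗ ε_ℓ⁻¹`: for `v ∉ S`, `v ∤ pℓ`, the
   root multiset `B` of the Frobenius polynomial `ι⁻¹(Q v)` of `r_ℓ` at `v` satisfies
   `B = {q_v⁻¹ β⁻¹ : β ∈ B}`, because this holds for `ι₀⁻¹(Q v)`, the Frobenius polynomial of the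
   symplectic-`ε_p⁻¹` representation `r` (`r(g)^{−ᵀ} = ε_p(g) · J r(g) J⁻¹` and
   `ε_p(Frob_v) = q_v ∈ ℚ`, arithmetic Frobenius), and `q_v` is rational; so `tr r_ℓ` and
   `tr (r_ℓ^∨ ⊗ ε_ℓ⁻¹)` agree on the Frobenius elements at `v ∉ S ∪ {p, ℓ}`, a dense set
   (Chebotarev), hence everywhere (continuity), and both representations are irreducible
   (step 3), so Brauer–Nesbitt in characteristic `0` gives an invertible `J` with
   `r_ℓ(g)ᵀ J r_ℓ(g) = ε_ℓ(g)⁻¹ J` for all `g ∈ Γ_ℚ`.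
6. [G3: Schur, twice — [BC] §1.1] `r_ℓ` is absolutely irreducible (`ℚ̄_ℓ` is algebraically
   closed), so `J` is unique up to a scalar and `Jᵀ`, which satisfies the same identity, is `±J`.
   Restricted to `G_{F'}`, `J` is a non-zero `G_{F'}`-equivariant pairing with multiplier
   `ε_ℓ⁻¹|_{G_{F'}}` on the irreducible `r_ℓ|_{G_{F'}} ≅ r_{ℓ,ı'}(π)` (step 3), so by Schur again
   `J = a · J'` (`a ≠ 0`, `J'` of step 4 transported along the isomorphism of step 2), hence
   `Jᵀ = −J`: `r_ℓ` is symplectic with multiplier `ε_ℓ⁻¹` (second conjunct; `det J ≠ 0` is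
   `IsUnit J.det` over the field `ℚ̄_ℓ`).
WHY irreducibility over `F'` is needed for the sign (and hence why both conjuncts live on the
positive-density set of step 3 rather than on a density-one set): if `r_ℓ|_{G_{F'}}` were
reducible with non-self-dual constituents paired off, `J|_{G_{F'}}` could have either sign
([BLGGT]'s and [P]'s parentheticals quoted above); [BLGGT] Thm. 5.5.2 (irreducibility of the
system on a density-one set) needs EXTREME regularity, which fails for symplectic weights
(`h₀ + h₃ = h₁ + h₂`), and [PT] Thm. 1.7 gives density one only at conjugation-invariant `λ`.
* WEAKER than print / NOT here:
  -- TODO(general form): [BC] Thm. 1.2 / Cor. 1.3 themselves (CM or totally real `F`, any `n`,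
  -- the sign of every self-dual irreducible factor of `r_{l,ı}(π)`, general `χ`), and the
  -- statement "`(r_{l,ı}(π), ε_l^{1−n} r_{l,ı}(χ))` is totally odd essentially conjugate
  -- self-dual" for the tree's automorphic Galois representations (it needs `r_{l,ı}(π)` over a
  -- totally real `F' ≠ ℚ`, not yet a tree object);
  -- TODO(general form): [PT] Thm. 1.7 as printed (density one at conjugation-invariant `λ`, the
  -- system `𝓡_π`, its field of definition `M_π`); [BLGGT] Cor. 4.5.2 as printed (potential
  -- automorphy over a Galois totally real `F'`); totally real / CM base field, general `n`,
  -- general multiplier `μ` (symplectic `μ(c_v) = −1` / orthogonal `μ(c_v) = +1`, the `GO_n` case).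

## References

* [BellaicheChenevier2011] Compositio Math. 147 (2011) 1337–1352: §1.1 (the sign), Thm. 1.2,
  Cor. 1.3 (totally real case; arXiv:0804.2860 §1.4 footnote for the dictionary).
* [BarnetlambEtAl2014] Ann. of Math. 179 (2014): §2.1 (pp. 17–18 of arXiv:1010.2561: essential
  self-duality, `GSp_n`/`GO_n` dictionary, the sign of `r_{l,ı}(π)`, "automorphic" pairs),
  Cor. 4.5.2 (p. 30), §5.1 (pp. 32–33), proof of Thm. 5.5.1 (= arXiv Thm. 5.4.1, pp. 39–40),
  Lemma 1.4.3 (p. 15), Thm. 2.1.1.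
* [PatrikisTaylor2014] Compositio Math. 151 (2015): Thm. 1.7, Introduction Thm. 4, Lemma 1.5.
* S. Patrikis, Math. Ann. 362 (2015) (arXiv:1306.1242), §3: the printed use of [BC] Cor. 1.3
  quoted above (context only; not a cite key of this fact).
* [NeukirchANT1999] VII (13.1) (Dirichlet density).
-/

noncomputable section

open scoped NumberField
open NumberField IsDedekindDomain Field Filter
open Literature.NumberTheory.PAdicHodge Literature.NumberTheory.LFunctions

namespace Literature.NumberTheory.GaloisRepresentations

/-- **Bellaïche–Chenevier 2011, Corollary 1.3 (the sign of the Galois representations of a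
RAESDC automorphic representation over a totally real field, as recalled in
Barnet-Lamb–Gee–Geraghty–Taylor 2014, §2.1), combined with Patrikis–Taylor 2015, Theorem 1.7
(= Introduction, Theorem 4), for the weakly compatible system through a potentially automorphic
`r : Γ_ℚ → GL₄(ℚ̄_p)` (Barnet-Lamb–Gee–Geraghty–Taylor 2014, Cor. 4.5.2), over `ℚ`, `n = 4`,
multiplier `ε⁻¹`.**  Let `p ≥ 11` be prime and let `r : Γ_ℚ → GL₄(ℚ̄_p)`, `H` satisfy VERBATIM the
hypotheses of `BLGGT2014_thm551_compatibleSystem_rat_GL4` (and of the sibling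
`PatrikisTaylor2015_thm17_irreducibleMembers_rat_GL4`): `r` continuous, unramified at all but
finitely many places, SYMPLECTIC WITH MULTIPLIER `ε_p⁻¹`; `H` a multiset of FOUR DISTINCT integers
which is the multiset of `τ`-labelled Hodge–Tate weights of `r` at the place `v ∣ p` for every
`ℚ_p`-label `τ` (pinned datum `fontainePstAdicCompletion v p hv`), where `r` is EITHER crystalline
with `H ⊂ [a, a + p − 2]` OR de Rham with `N = 0` on every attached Weil–Deligne representation and
upper triangular in some frame; and the residual representation — some continuous
`ρbar : Γ_ℚ → GL₄(k)`, `k` finite of characteristic `p`, to whose base change to `k̄` the integral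
characteristic polynomials of `r` reduce along `red : 𝒪_{ℚ̄_p} → k̄` — irreducible on
`Γ_{ℚ(ζ_p)} = ker ε̄_p`.  Let `(S, Q, H, 𝓡)` be ANY rank-`4` weakly compatible system over `ℚ`
(`IsWeaklyCompatibleSystemRat 4 S Q H 𝓡`) of which `r` is the `(p, ι₀)`-member, `𝓡 p ι₀ = r`.
THEN there is a set `L'` of rational primes having a Dirichlet density `c > 0`
(`HasDirichletDensity L' c`) such that for every prime `ℓ ∈ L'` and every `ι : ℚ̄_ℓ ≃ ℂ` the
member `𝓡 ℓ ι` is IRREDUCIBLE and SYMPLECTIC WITH MULTIPLIER `ε_ℓ⁻¹` (`∃ J`, `Jᵀ = −J`, `det J` a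
unit, `(𝓡 ℓ ι)(g)ᵀ J (𝓡 ℓ ι)(g) = ε_ℓ(g)⁻¹ • J` for all `g ∈ Γ_ℚ`; the multiplier function spelled
exactly as in the hypothesis at `p`).  Printed inputs: [BLGGT] Cor. 4.5.2 ("there is a Galois
totally real extension `F⁺'/F⁺` such that `(r|_{G_{F⁺'}}, μ|_{G_{F⁺'}})` is automorphic of level
prime to `l`") giving `r|_{G_{F'}} ≅ r_{p,ı}(π)`, `r_{p,ı}(χ) = ε_p²`, for a RAESDC `(π, χ)` of
`GL₄(𝔸_{F'})`; [PT] Thm. 1.7 / Introduction Thm. 4 ("there is a positive Dirichlet density set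
`𝓛` such that, for all `l ∈ 𝓛` and all `ı : ℚ̄_l ≅ ℂ`, the representation `r_{l,ı}(π)` is
irreducible"); [BC] Cor. 1.3 as recalled in [BLGGT] §2.1 ("The pair
`(r_{l,ı}(π), ε_l^{1−n} r_{l,ı}(χ))` is totally odd, essentially conjugate self-dual. (See
Theorem 1.2 and Corollary 1.3 of [belchen].)" together with "If `F` is totally real then `(r, μ)`
is essentially conjugate self-dual if and only if `r` factors through `GSp_n(ℚ̄_l)` (if
`μ(c_v) = −ε_v`) … with multiplier `μ`").  Glue: `𝓡 ℓ ι|_{G_{F'}} ≅ r_{ℓ,ı'}(π)`,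
`ı' = ı ∘ ι₀⁻¹ ∘ ι`, and `r_{ℓ,ı'}(χ) = ε_ℓ²` (Chebotarev, Brauer–Nesbitt over `F'`);
`𝓡 ℓ ι ≅ (𝓡 ℓ ι)^∨ ⊗ ε_ℓ⁻¹` (the Frobenius root multisets of the system are stable under
`β ↦ q_v⁻¹β⁻¹`, as they are at `(p, ι₀)`; Chebotarev, Brauer–Nesbitt over `ℚ`); the `Γ_ℚ`-pairing
is unique up to scalars (Schur, `𝓡 ℓ ι` irreducible) and restricts to the unique — alternating —
`G_{F'}`-pairing of the irreducible `r_{ℓ,ı'}(π)` (Schur), hence is alternating.  Module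
docstring, "Derivation", steps 1–6, with the printed steps and the glue marked, and why both
conjuncts come on ONE positive-density set.  Named fact (D-0014); users take
`(h : BellaicheChenevier2011_cor13_irreducibleSymplecticMembers_rat_GL4)`; it implies the sibling
(`….irreducibleMembers`).
-- TODO(general form): [BC] Thm. 1.2 / Cor. 1.3 as printed (CM or totally real `F`, any `n`, every
-- self-dual irreducible factor, general `χ`); [PT] Thm. 1.7 as printed (density one at
-- conjugation-invariant `λ`); [BLGGT] Cor. 4.5.2 as printed; general multiplier `μ`, `GO_n`.
[cite: BellaicheChenevier2011, Cor. 1.3 (with Thm. 1.2 and §1.1), as recalled in BarnetlambEtAl2014 §2.1]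
[cite: PatrikisTaylor2014, Thm. 1.7 (= Introduction Thm. 4) with Lemma 1.5]
[cite: BarnetlambEtAl2014, Cor. 4.5.2 with §2.1, §5.1 and Lemma 1.4.3] -/
def BellaicheChenevier2011_cor13_irreducibleSymplecticMembers_rat_GL4 : Prop :=
  ∀ (p : ℕ) [Fact p.Prime], 11 ≤ p →
    ∀ (r : FramedGaloisRep ℚ (PadicAlgCl p) 4) (H : Multiset ℤ),
      -- `r` is unramified at all but finitely many primes
      (∀ᶠ v : HeightOneSpectrum (𝓞 ℚ) in cofinite, r.IsUnramifiedAt v) →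
      -- `(r, ε_p⁻¹)` totally odd essentially self-dual: symplectic with multiplier `ε_p⁻¹`
      r.IsSymplecticWithMultiplierFun (fun g => algebraMap ℚ_[p] (PadicAlgCl p)
        ((((GaloisRep.cyclotomicCharacter ℚ p g)⁻¹ : ℤ_[p]ˣ) : ℤ_[p]) : ℚ_[p])) →
      -- regularity: `H` has four distinct elements …
      H.Nodup → Multiset.card H = 4 →
      -- … and is the multiset of labelled Hodge–Tate weights of `r` at `v ∣ p`; there `r` is
      -- potentially diagonalizable by Lemma 1.4.3: (2) Fontaine–Laffaille, or (1) potentially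
      -- crystalline with an invariant full flag
      (∀ (v : HeightOneSpectrum (𝓞 ℚ)) (hv : ((p : ℕ) : 𝓞 ℚ) ∈ v.asIdeal),
        let D := PAdicHodge.fontainePstAdicCompletion v p hv
        (letI := D.algebra
         ∀ τ : v.adicCompletion ℚ →ₐ[ℚ_[p]] PadicAlgCl p,
          r.labelledHodgeTateWeightsAt v D.algebra D.𝔅 τ.toRingHom = H) ∧
        ((D.IsCrystallineFramed (r.toLocal v) ∧
            ∃ a : ℤ, ∀ h ∈ H, a ≤ h ∧ h ≤ a + ((p : ℤ) - 2)) ∨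
          (D.IsDeRhamFramed (r.toLocal v) ∧
            (∀ W, D.IsWeilDeligneOf (r.toLocal v) W → W.N = 0) ∧
            ∃ g : GL (Fin 4) (PadicAlgCl p),
              ∀ (σ : absoluteGaloisGroup (v.adicCompletion ℚ)) (i j : Fin 4), j < i →
                ((g * r.toLocal v σ * g⁻¹ : GL (Fin 4) (PadicAlgCl p)) :
                  Matrix (Fin 4) (Fin 4) (PadicAlgCl p)) i j = 0))) →
      -- the residual representation `r̄`, read in `k̄` for a finite field `k` of characteristic `p`
      ∀ (k : Type) [Field k] [Fintype k] [CharP k p] [TopologicalSpace k] [DiscreteTopology k]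
        (ρbar : FramedGaloisRep ℚ k 4)
        (red : (Valued.v : Valuation (PadicAlgCl p) NNReal).valuationSubring →+*
          AlgebraicClosure k),
        (∀ g : absoluteGaloisGroup ℚ,
          ∃ P : Polynomial (Valued.v : Valuation (PadicAlgCl p) NNReal).valuationSubring,
            P.map (Valued.v : Valuation (PadicAlgCl p) NNReal).valuationSubring.subtype =
                FramedRep.charpoly r g ∧
              P.map red = (FramedRep.charpoly ρbar g).map (algebraMap k (AlgebraicClosure k))) →
        -- `r̄|_{Γ_{ℚ(ζ_p)}}` is irreducible (`Γ_{ℚ(ζ_p)} = ker ε̄_p`)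
        Representation.IsIrreducible
          (((FramedRep.baseChangeRepresentation (algebraMap k (AlgebraicClosure k)) ρbar).comp
              (modPCyclotomicCharacterZMod ℚ p).ker.subtype :
            Representation (AlgebraicClosure k) (modPCyclotomicCharacterZMod ℚ p).ker
              (Fin 4 → AlgebraicClosure k))) →
      -- ANY weakly compatible system of weight `H` of which `r` is the `(p, ι₀)`-member …
      ∀ (S : Finset (HeightOneSpectrum (𝓞 ℚ))) (Q : HeightOneSpectrum (𝓞 ℚ) → Polynomial ℂ)
        (ι₀ : PadicAlgCl p ≃+* ℂ)
        (𝓡 : ∀ (ℓ : ℕ) [Fact ℓ.Prime], (PadicAlgCl ℓ ≃+* ℂ) → FramedGaloisRep ℚ (PadicAlgCl ℓ) 4),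
        𝓡 p ι₀ = r → IsWeaklyCompatibleSystemRat 4 S Q H 𝓡 →
      -- … CONCLUSION: at a set of primes of positive Dirichlet density its members are
      -- irreducible AND symplectic with multiplier `ε_ℓ⁻¹`
      ∃ (L' : Set ℕ) (c : ℝ), 0 < c ∧ HasDirichletDensity L' c ∧
        ∀ (ℓ : ℕ) [Fact ℓ.Prime], ℓ ∈ L' → ∀ ι : PadicAlgCl ℓ ≃+* ℂ,
          (𝓡 ℓ ι).toGaloisRep.IsIrreducible ∧
            (𝓡 ℓ ι).IsSymplecticWithMultiplierFun (fun g => algebraMap ℚ_[ℓ] (PadicAlgCl ℓ)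
              ((((GaloisRep.cyclotomicCharacter ℚ ℓ g)⁻¹ : ℤ_[ℓ]ˣ) : ℤ_[ℓ]) : ℚ_[ℓ]))

/-- The composite fact implies its sibling `PatrikisTaylor2015_thm17_irreducibleMembers_rat_GL4`
(drop the symplecticity conjunct: same binders, same set `L'`, same density `c`). [folklore] -/
theorem BellaicheChenevier2011_cor13_irreducibleSymplecticMembers_rat_GL4.irreducibleMembers
    (h : BellaicheChenevier2011_cor13_irreducibleSymplecticMembers_rat_GL4) :
    PatrikisTaylor2015_thm17_irreducibleMembers_rat_GL4 := by
  intro p _ hp r H hunr hsymp hreg hcard hp_adic k _ _ _ _ _ ρbar red hred hbig S Q ι₀ 𝓡 hr h𝓡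
  obtain ⟨L', c, hc, hL', hmem⟩ :=
    h p hp r H hunr hsymp hreg hcard hp_adic k ρbar red hred hbig S Q ι₀ 𝓡 hr h𝓡
  exact ⟨L', c, hc, hL', fun ℓ _ hℓ ι => (hmem ℓ hℓ ι).1⟩

end Literature.NumberTheory.GaloisRepresentations

end
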